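import Summits.QuantumFields.BalabanUV.Beta.CovariantTowerWRS
import Summits.QuantumFields.BalabanUV.Beta.UnitLatticeDecoratedRowData

/-!
# Beta / CovariantTowerRowData — THE JUNCTION, PART 2: interface item (I1)'s TYPE inhabited from a general transport U
# in the MODEL — the s-DECORATED generalized-random-walk expansion of the inverse of the k-fold covariant tower operator
# Δ′ = Δ_U + Σ_{l≤k} a_l·G_lᵀG_l (pv21 MODEL; b05 partition at scale M₀; decoration cells = the M₀-boxes, one free
# coordinate s(Δ₀) = σ at a time, the others frozen on ‖τ‖ ≤ e^{κ₁}) IS an `AnalyticWalkSum216RowData.RowData` family —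
# an4's volume-free (2.16)-currency, the hypothesis type of NODE A's kernel chain — with explicit constant
# e^{κ₁P}·ν·C_L·(1 − ρ)⁻¹ at the shifted rate κ + κ₁P/M₀, and AT s ≡ 1 ITS SUM IS Δ′⁻¹; every torus, every isometric U
# (unit `b2b-balaban-beta-d4-p2`, GEN 5; fourth module of `CovariantTowerMatrix → CovariantTowerLocal → CovariantTowerWRS
# → CovariantTowerRowData`; d4-p3's `UnitLatticeDecoratedRowData.rowData_decFamily_tube` ∕ `termSum_decFamily_one` BY NAME)

HONEST FRAMING: discharging `BetaPertH` makes Bałaban's UV stability UNCONDITIONAL — NOT the continuum limit, NOT the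
Clay problem.  HONEST DEPENDENCY (verbatim): «continuum YM on T⁴ ⇐ BetaPertH ∧ nine spine estimates (0/9 proved);
BetaPertH ⇐ (D1) ∧ (D4) ∧ CAP+tail; G-an2-4 gates asym, D1 and NE2/3/4.»  THIS MODULE DISCHARGES NOTHING of `BetaPertH`,
asserts NOTHING printed and cites nothing as a fact (ABSOLUTE RULE): [folklore] kernel theorems about the component MODEL
(pv21 `B9Thm37GlueTorusCov*`, model of [B9] = `Balaban1985BackgroundPropagators`, Commun. Math. Phys. 99 (1985) 389–434;
SHAPES modelled: Thm 3.10 p. 416 «The constant O(1) depends on d and L only» — here: on (d, M, k, a, c, w, |Cp|, M₀, κ, κ₁),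
NOT on the volume, NOT on U; and [II] = `Balaban1988RG2Cluster` p. 3 / (1.11) p. 5: the s-decoration of walk terms by the
cubes their localization domain meets).  WHAT THIS IS FOR ROW D4 (census `BETA/REMAINDER-BETA.md` §10.26, the O.2
INTERFACE LIST): item (I1) «RowData of G̃₀'s decorated expansion» has its TYPE inhabited, in the kernel, by an operator
built from an ARBITRARY bond transport U — for the SCALAR prototype Δ′ of the pv21 model, with k-DEPENDENT constants
(σ_k, θ_D: O.2 item (v) untouched), bond-step metric, ℓ^∞-weighted currency.  It is NOT G̃₀ (vector side, constraints,
print's norms): O.2 items (i), (ii), (iv), (v) stand.  Row class unchanged; D4 DISCHARGE NO DATE.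

CONTENT.
* §1 `WRS.of_rate_le` (rate monotonicity); decoration cells `cellTorus` (a box whose partition function sees the point;
  `dist_cellTorus_lt`: within M₀ of its centre), `omegaDiam`/`diam_ETorus` (hull diameter 2(M₀ + 1 + 2S_k)),
  `packR`/`packNumber`/`pack_cellTorus` (packing of the cells at radius R = M₀ + diam, b05 `hnu_holds`).
* §2 `rateShift κ₁ = κ₁·P/M₀`, `rowConst`, **`rowData_tower_torus`**: `RowData κ dist e^{κ₁} (decFamily h (cmat Δ′ − 1) L
  (tubeDec cell E) τ Δ₀) (decMaj e^{κ₁P} (κ₁P/M₀) …) rowConst` for ‖τ‖ ≤ e^{κ₁}, 0 ≤ κ, 0 ≤ κ₁, κ + κ₁P/M₀ < θ_D and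
  ρ(κ + κ₁P/M₀) < 1.
* §3 `cmat_inverse_towerOp` ((cmat Δ′)⁻¹ = cmat Δ′⁻¹), **`wrs_inverse_tower_torus`** (real-entry (2.16)-currency bound:
  Σ_q |Δ′⁻¹(δ_q)(p)|·e^{κ·dist(p,q)} ≤ ν·C_L·(1 − ρ)⁻¹ ∀ p), **`termSum_tower_torus_one`**: at τ ≡ 1, σ = 1 the summed
  family is `cmat Δ′⁻¹` (κ₁ > 0).
NOT HERE / NOT CLAIMED: anything about Bałaban's G̃₀, H′, vector fields, Hölder norms, k-uniformity; any printed bound.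
Row D4: RECORDS value (junction O.2(model) → NODE A currency complete for the scalar prototype); class of (T3)/NODE O.2
unchanged; D4 DISCHARGE NO DATE; NOT BetaPertH, NOT continuum, NOT Clay.
-/

namespace Summit.QuantumFields.BalabanUV.Beta.CovariantTowerRowData

open Finset Metric
open Literature.MathematicalPhysics.QuantumFieldTheory.Balaban1983to89
open B9Thm37Sum B9Thm37Glue B9Thm37GluePU B9Thm37GlueTorusInv B9Thm37GlueTorusCov B9Thm37GlueTorusCovComp
open B9Thm37GlueTorusCovPoinc (tdepth_le card_block_le)
open B9Thm37GlueTorusCovLevels B9Thm37GlueTorusCovTower B9Thm37GlueTorusCovTowerDir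
open B9Thm37GlueTorusCovTowerPU (omegaBall omegaBall_zero_or_one omegaBall_eq_one)
open B13PerturbativeStep (WRS wrs WeightHyp)
open Summit.QuantumFields.BalabanUV.Beta.CovariantTowerDecay (towerS)
open Summit.QuantumFields.BalabanUV.Beta.CovariantTowerCover (coverNumber coverNumber_nonneg sum_omegaBall_le
  dist_lt_of_omegaBall_eq_one)
open Summit.QuantumFields.BalabanUV.Beta.CovariantTowerMatrix
open Summit.QuantumFields.BalabanUV.Beta.CovariantTowerLocal
open Summit.QuantumFields.BalabanUV.Beta.CovariantTowerWRS
open Summit.QuantumFields.BalabanUV.Beta.UnitLatticeWalkInversion (Hd Pj Ptot Rem resummation_identity wrs_Rem)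
open Summit.QuantumFields.BalabanUV.Beta.UnitLatticeTubeCount (pathLen tubeDec)
open Summit.QuantumFields.BalabanUV.Beta.UnitLatticeDecoratedRowData (Walk decFamily decMaj rowData_decFamily_tube
  termSum_decFamily_one)
open Summit.QuantumFields.BalabanUV.Beta.AnalyticWalkSum216 (termSum majSum)
open Summit.QuantumFields.BalabanUV.Beta.AnalyticWalkSum216RowData (RowData)
open B5TorusCover (UT Ctr ctrU hnu_holds)
open B5SmoothPartition (hSU sum_hSU_sq)

noncomputable section

/-! ## §1  Rate monotonicity; decoration cells, hull diameter, packing -/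

section Rate

variable {Y : Type*} [Fintype Y] {κ κ' : ℝ} {dY : Y → Y → ℝ}

/-- **Lowering the rate keeps a `WRS` bound** (d ≥ 0, κ ≤ κ′). [folklore] -/
theorem WRS.of_rate_le {A : Matrix Y Y ℂ} {ρ : ℝ} (h : WRS κ' dY A ρ) (hκ : κ ≤ κ') (hd : ∀ i j, 0 ≤ dY i j) :
    WRS κ dY A ρ := fun i =>
  le_trans (Finset.sum_le_sum fun j _ => mul_le_mul_of_nonneg_left
    (Real.exp_le_exp.mpr (mul_le_mul_of_nonneg_right hκ (hd i j))) (norm_nonneg _)) (h i)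

end Rate

section Cells

variable {d : ℕ} {N : Fin d → ℕ} [∀ i, NeZero (N i)] [NeZero d] {Cp : Type}

omit [∀ i, NeZero (N i)] [NeZero d] in
/-- Every torus site is seen by some partition function (Σ_z h_z² = 1). [folklore] -/
theorem exists_hSU_ne_zero {M₀ : ℕ} (hM₀ : 1 ≤ M₀) (hdiv₀ : ∀ i, M₀ ∣ N i) (h2N : ∀ i, 2 * M₀ ≤ N i) (x : UT N) :
    ∃ z : Ctr N M₀, hSU N M₀ z x ≠ 0 := by
  by_contra h
  push Not at h
  have h1 := sum_hSU_sq N hM₀ hdiv₀ h2N x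
  simp [h] at h1

omit [NeZero d] in
/-- MODEL bookkeeping: **the decoration cell of a point** — a box whose partition function sees its site (a choice; the
cells are the M₀-boxes, as the cubes Δ of [II] §1 are for print). [folklore] -/
def cellTorus {M₀ : ℕ} (hM₀ : 1 ≤ M₀) (hdiv₀ : ∀ i, M₀ ∣ N i) (h2N : ∀ i, 2 * M₀ ≤ N i) (Cp : Type) :
    UT N × Cp → Ctr N M₀ :=
  fun p => Classical.choose (exists_hSU_ne_zero hM₀ hdiv₀ h2N p.1)

omit [NeZero d] in
/-- The site of a point is within M₀ of the centre of its cell (b05: h_z vanishes at distance ≥ M₀). [folklore] -/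
theorem dist_cellTorus_lt {M₀ : ℕ} (hM₀ : 1 ≤ M₀) (hdiv₀ : ∀ i, M₀ ∣ N i) (h2N : ∀ i, 2 * M₀ ≤ N i)
    (p : UT N × Cp) : dist p.1 (ctrU N M₀ (cellTorus hM₀ hdiv₀ h2N Cp p)) < M₀ := by
  have h := Classical.choose_spec (exists_hSU_ne_zero hM₀ hdiv₀ h2N p.1)
  by_contra hfar
  exact h (hSU_eq_zero_of_far hM₀ (not_lt.mp hfar))

/-- MODEL bookkeeping: **the diameter bound of a hull Ω₀(z)**, 2(M₀ + 1 + 2S_k). [folklore] -/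
def omegaDiam (d : ℕ) (M : ℕ → ℕ) (k M₀ : ℕ) : ℝ := 2 * ((M₀ : ℝ) + 1 + 2 * (towerS (fun j => d * (M j - 1)) k : ℝ))

/-- The diameter bound is nonnegative. [folklore] -/
theorem omegaDiam_nonneg (d : ℕ) (M : ℕ → ℕ) (k M₀ : ℕ) : 0 ≤ omegaDiam d M k M₀ := by
  unfold omegaDiam; positivity

/-- **Two points of one hull Ω₀(z) are within 2(M₀ + 1 + 2S_k).** [folklore] -/
theorem diam_ETorus [Fintype Cp] {M : ℕ → ℕ} (hM : ∀ j, 1 ≤ M j) (hdiv : ∀ j i, M j ∣ N i) (k M₀ : ℕ)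
    (z : Ctr N M₀) (p : UT N × Cp) (hp : p ∈ ETorus hM hdiv k M₀ Cp z) (q : UT N × Cp)
    (hq : q ∈ ETorus hM hdiv k M₀ Cp z) : dTorus N Cp p q ≤ omegaDiam d M k M₀ := by
  rw [mem_ETorus] at hp hq
  have h1 := dist_lt_of_omegaBall_eq_one hM hdiv k M₀ z p.1 hp
  have h2 := dist_lt_of_omegaBall_eq_one hM hdiv k M₀ z q.1 hq
  rw [dTorus_apply]
  calc dist p.1 q.1 ≤ dist p.1 (ctrU N M₀ z) + dist (ctrU N M₀ z) q.1 := dist_triangle _ _ _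
    _ ≤ omegaDiam d M k M₀ := by rw [dist_comm (ctrU N M₀ z) q.1, omegaDiam]; linarith

/-- MODEL bookkeeping: **the packing radius** R = M₀ + diam (anchor spacing r := M₀). [folklore] -/
def packR (d : ℕ) (M : ℕ → ℕ) (k M₀ : ℕ) : ℝ := (M₀ : ℝ) + omegaDiam d M k M₀

/-- MODEL bookkeeping: **the packing number of the cells at radius R**, P = ⌊(2(R + M₀)/M₀ + 3)^d⌋. [folklore] -/
def packNumber (d : ℕ) (M : ℕ → ℕ) (k M₀ : ℕ) : ℕ := ⌊(2 * ((packR d M k M₀ + M₀) / M₀) + 3) ^ d⌋₊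

omit [NeZero d] in
/-- **Packing**: the cells of the points within R of a given point number at most P (b05's sparse count of the centres
within R + M₀). [folklore] -/
theorem pack_cellTorus {M : ℕ → ℕ} (k : ℕ) {M₀ : ℕ} (hM₀ : 1 ≤ M₀) (hdiv₀ : ∀ i, M₀ ∣ N i)
    (h2N : ∀ i, 2 * M₀ ≤ N i) (a : UT N × Cp) :
    ∃ S : Finset (Ctr N M₀), S.card ≤ packNumber d M k M₀ ∧
      ∀ z : UT N × Cp, dTorus N Cp a z ≤ packR d M k M₀ → cellTorus hM₀ hdiv₀ h2N Cp z ∈ S := by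
  classical
  have hM0 : (0 : ℝ) < M₀ := by exact_mod_cast hM₀
  set cbar : ℝ := (packR d M k M₀ + M₀) / M₀ with hcbar
  have hR0 : 0 ≤ packR d M k M₀ := by
    unfold packR; exact add_nonneg (Nat.cast_nonneg _) (omegaDiam_nonneg d M k M₀)
  have hc0 : 0 ≤ cbar := by rw [hcbar]; positivity
  have hcM : cbar * M₀ = packR d M k M₀ + M₀ := by rw [hcbar]; field_simp
  refine ⟨univ.filter fun β : Ctr N M₀ => dist a.1 (ctrU N M₀ β) ≤ cbar * M₀, ?_, fun z hz => ?_⟩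
  · have h := hnu_holds N hM₀ hc0 a.1
    exact Nat.le_floor h
  · rw [Finset.mem_filter]
    refine ⟨mem_univ _, ?_⟩
    rw [hcM]
    rw [dTorus_apply] at hz
    have h1 := dist_cellTorus_lt hM₀ hdiv₀ h2N (Cp := Cp) z
    calc dist a.1 (ctrU N M₀ (cellTorus hM₀ hdiv₀ h2N Cp z))
        ≤ dist a.1 z.1 + dist z.1 (ctrU N M₀ (cellTorus hM₀ hdiv₀ h2N Cp z)) := dist_triangle _ _ _
      _ ≤ packR d M k M₀ + M₀ := add_le_add hz h1.le

end Cells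

/-! ## §2  The decorated walk expansion of Δ′⁻¹ is a `RowData` family -/

section Row

variable {d : ℕ} {N : Fin d → ℕ} [∀ i, NeZero (N i)] [NeZero d] {Cp : Type} [Fintype Cp] [DecidableEq Cp]

/-- MODEL bookkeeping: **the rate shift of the decoration**, κ₁·P/M₀ (P cells per unit of path length M₀). [folklore] -/
def rateShift (d : ℕ) (M : ℕ → ℕ) (k M₀ : ℕ) (κ₁ : ℝ) : ℝ := κ₁ * ((packNumber d M k M₀ : ℝ) / (M₀ : ℝ))

/-- MODEL bookkeeping: **the RowData constant**, e^{κ₁P}·(ν·C_L(κ′))·(1 − ρ(κ′))⁻¹ at κ′ = κ + κ₁P/M₀. [folklore] -/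
def rowConst (d : ℕ) (M : ℕ → ℕ) (amin wmin cmin cmax wmax : ℝ) (k : ℕ) (a : Fin (k + 1) → ℝ) (nC : ℕ) (M₀ : ℕ)
    (κ κ₁ : ℝ) : ℝ :=
  Real.exp (κ₁ * packNumber d M k M₀) *
    (coverNumber d M k M₀ * localConst d M amin wmin cmin cmax wmax k a nC (κ + rateShift d M k M₀ κ₁)) *
      (1 - wrsSmallness d M amin wmin cmin cmax wmax k a nC M₀ (κ + rateShift d M k M₀ κ₁))⁻¹

/-- **(I1)-SHAPE IN THE MODEL: THE s-DECORATED WALK EXPANSION OF THE k-FOLD COVARIANT TOWER INVERSE IS A `RowData`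
FAMILY** (an4's volume-free (2.16)-currency; d4-p3's `rowData_decFamily_tube` BY NAME on the torus data of
`CovariantTowerWRS` with the cells, diameter and packing of §1).  For 0 ≤ κ, 0 ≤ κ₁, κ′ := κ + κ₁P/M₀ < θ_D,
ρ(κ′) < 1, any frozen decoration values ‖τ‖ ≤ e^{κ₁} and any free cell Δ₀:
`RowData κ dist e^{κ₁} (decFamily h (cmat Δ′ − 1) L (tubeDec cell E) τ Δ₀) (decMaj e^{κ₁P} (κ₁P/M₀) dist h (cmat Δ′ − 1) L)
(e^{κ₁P}·ν·C_L(κ′)·(1 − ρ(κ′))⁻¹)` — every torus (M_j ∣ N_i, M₀ ∣ N_i, 2M₀ ≤ N_i), every isometric transport U. [folklore] -/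
theorem rowData_tower_torus {M : ℕ → ℕ} (hM : ∀ j, 1 ≤ M j) (hdiv : ∀ j i, M j ∣ N i)
    (c : UT N × Fin d → ℝ) {cmin cmax : ℝ} (hcmin : 0 < cmin) (hc : ∀ b, cmin ≤ |c b|) (hc' : ∀ b, |c b| ≤ cmax)
    (Rm : UT N × Fin d → Cp → Cp → ℝ) (hRm : ∀ b i j, ∑ k, Rm b k i * Rm b k j = if i = j then (1 : ℝ) else 0)
    (k : ℕ) (w : Fin (k + 1) → UT N → ℝ) {wmax : ℝ} (hw' : ∀ l y, |w l y| ≤ wmax) {a : Fin (k + 1) → ℝ}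
    (ha : ∀ l, 0 ≤ a l) {amin wmin : ℝ} (hamin : 0 < amin) (hwmin : 0 < wmin)
    (hcov : ∀ x, ∃ l : Fin (k + 1), amin ≤ a l ∧ wmin ≤ |w l (towerBlk (torusTower hM hdiv) (l : ℕ) x)|)
    {M₀ : ℕ} (hM₀ : 1 ≤ M₀) (hdiv₀ : ∀ i, M₀ ∣ N i) (h2N : ∀ i, 2 * M₀ ≤ N i)
    {κ κ₁ : ℝ} (hκ0 : 0 ≤ κ) (hκ₁ : 0 ≤ κ₁)
    (hκ : κ + rateShift d M k M₀ κ₁ < thetaD d M amin wmin cmin cmax wmax k a)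
    (hρ : wrsSmallness d M amin wmin cmin cmax wmax k a (Fintype.card Cp) M₀ (κ + rateShift d M k M₀ κ₁) < 1)
    (τ : Ctr N M₀ → ℂ) (hτ : ∀ δ, ‖τ δ‖ ≤ Real.exp κ₁) (Δ₀ : Ctr N M₀) :
    RowData κ (dTorus N Cp) (Real.exp κ₁)
      (decFamily (hTorus N Cp M₀) (cmat (towerOpT hM hdiv c Rm k w a) - 1) (LTorus hM hdiv c Rm k w a M₀)
        (tubeDec (cellTorus hM₀ hdiv₀ h2N Cp) (ETorus hM hdiv k M₀ Cp)) τ Δ₀)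
      (decMaj (Real.exp (κ₁ * packNumber d M k M₀)) (rateShift d M k M₀ κ₁) (dTorus N Cp) (hTorus N Cp M₀)
        (cmat (towerOpT hM hdiv c Rm k w a) - 1) (LTorus hM hdiv c Rm k w a M₀))
      (rowConst d M amin wmin cmin cmax wmax k a (Fintype.card Cp) M₀ κ κ₁) := by
  have hd0 : (0 : ℝ) < d := by exact_mod_cast Nat.pos_of_ne_zero (NeZero.ne d)
  have hM0 : (0 : ℝ) < M₀ := by exact_mod_cast hM₀
  have hcmax : 0 ≤ cmax := le_trans (le_trans hcmin.le (hc (ctrU N M₀ (fun _ => ⟨0, B5TorusCover.one_le_nC _ _⟩),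
    ⟨0, Nat.pos_of_ne_zero (NeZero.ne d)⟩))) (hc' _)
  have hwmax : 0 ≤ wmax := (abs_nonneg _).trans (hw' 0 (ctrU N M₀ fun _ => ⟨0, B5TorusCover.one_le_nC _ _⟩))
  have hW : ∀ (l : Fin (k + 1)) (x : UT N), |w l (towerBlk (torusTower hM hdiv) (l : ℕ) x)| ≤ wmax :=
    fun l x => hw' l _
  set κ' := κ + rateShift d M k M₀ κ₁ with hκ'def
  have hκ'0 : 0 ≤ κ' := add_nonneg hκ0 (by unfold rateShift; positivity)
  have hshift : κ + κ₁ * ((packNumber d M k M₀ : ℝ) / (M₀ : ℝ)) = κ' := rfl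
  have h := rowData_decFamily_tube (weightHyp_dTorus (N := N) (Cp := Cp) hκ0)
    (cmat (towerOpT hM hdiv c Rm k w a) - 1) (hTorus N Cp M₀) (ETorus hM hdiv k M₀ Cp) (LTorus hM hdiv c Rm k w a M₀)
    (fun z p hp => hTorus_supp hM hdiv k hM₀ z p hp) (hTorus_abs M₀)
    (M := (M₀ : ℝ) / (4 * d)) (N := coverNumber d M k M₀)
    (C_L := localConst d M amin wmin cmin cmax wmax k a (Fintype.card Cp) κ')
    (K₁ := momentConst d M cmax wmax k a (Fintype.card Cp) κ') (κ₁ := κ₁) (r := (M₀ : ℝ))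
    (D := omegaDiam d M k M₀) (R := packR d M k M₀)
    (by positivity) (fun z p q => hTorus_lip hM₀ z p q) (fun p => card_ETorus_le hM hdiv k hM₀ p)
    (localConst_nonneg d M cmin cmax wmax k a _ hκ.le hamin hwmin) hκ₁ hM0 (le_of_eq rfl)
    (cellTorus hM₀ hdiv₀ h2N Cp) (pack_cellTorus k hM₀ hdiv₀ h2N)
    (fun z p hp q hq => diam_ETorus hM hdiv k M₀ z p hp q hq)
    (fun z => by
      rw [hshift]
      exact wrs_LTorus hM hdiv c hcmin hc hc' Rm hRm k w hw' ha hamin hwmin hcov hκ M₀ z)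
    (fun p => by
      rw [hshift]
      simpa [dTorus_apply, towerOpT] using
        firstMoment_towerOp_le hM hdiv c hcmax hc' Rm hRm k
          (W := fun l x => w l (towerBlk (torusTower hM hdiv) (l : ℕ) x)) hwmax hW ha hκ'0 p)
    (by simpa [wrsSmallness, hκ'def] using hρ) τ hτ Δ₀
  simpa [rowConst, wrsSmallness, rateShift, hκ'def] using h

/-! ## §3  The inverse in the matrix currency; at s ≡ 1 the summed family is Δ′⁻¹ -/

/-- **`(cmat Δ′)⁻¹ = cmat Δ′⁻¹`**: the matrix inverse of the engine is the matrix of pv21's `Ring.inverse Δ′` (Δ′ a unit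
under the full cover, `isUnit_towerOp`). [folklore] -/
theorem cmat_inverse_towerOp {M : ℕ → ℕ} (hM : ∀ j, 1 ≤ M j) (hdiv : ∀ j i, M j ∣ N i) (c : UT N × Fin d → ℝ)
    {cmin : ℝ} (hcmin : 0 < cmin) (hc : ∀ b, cmin ≤ |c b|) (Rm : UT N × Fin d → Cp → Cp → ℝ)
    (hRm : ∀ b i j, ∑ k, Rm b k i * Rm b k j = if i = j then (1 : ℝ) else 0) (k : ℕ)
    (w : Fin (k + 1) → UT N → ℝ) {a : Fin (k + 1) → ℝ} (ha : ∀ l, 0 ≤ a l) {amin wmin : ℝ} (hamin : 0 < amin)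
    (hwmin : 0 < wmin)
    (hcov : ∀ x, ∃ l : Fin (k + 1), amin ≤ a l ∧ wmin ≤ |w l (towerBlk (torusTower hM hdiv) (l : ℕ) x)|) :
    cmat (Ring.inverse (towerOpT hM hdiv c Rm k w a)) = (cmat (towerOpT hM hdiv c Rm k w a))⁻¹ :=
  cmat_ringInverse (isUnit_towerOp (torusTower hM hdiv) Rm hRm hcmin hc (fun j x => tdepth_le (hM j) x)
    (fun j β => card_block_le (hM j) (hdiv j) β) k w ha hamin hwmin hcov)

/-- **THE k-FOLD COVARIANT TOWER INVERSE IS A (2.16)-CURRENCY KERNEL AT A FIXED RATE (MODEL of (3.42) entry 1 / Thm 3.1 in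
the exponentially weighted row-sum norm; real-entry form).**  Under the hypotheses of `walkInversion_tower_torus`, for
every p,  Σ_q |Δ′⁻¹(δ_q)(p)|·e^{κ·dist(p,q)} ≤ ν_k(M₀)·C_L(κ)·(1 − ρ)⁻¹ — the constant sees (d, M, k, a, c, w, |Cp|, M₀, κ)
and NOT the volume N, NOT the transport U. [folklore] -/
theorem wrs_inverse_tower_torus {M : ℕ → ℕ} (hM : ∀ j, 1 ≤ M j) (hdiv : ∀ j i, M j ∣ N i)
    (c : UT N × Fin d → ℝ) {cmin cmax : ℝ} (hcmin : 0 < cmin) (hc : ∀ b, cmin ≤ |c b|) (hc' : ∀ b, |c b| ≤ cmax)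
    (Rm : UT N × Fin d → Cp → Cp → ℝ) (hRm : ∀ b i j, ∑ k, Rm b k i * Rm b k j = if i = j then (1 : ℝ) else 0)
    (k : ℕ) (w : Fin (k + 1) → UT N → ℝ) {wmax : ℝ} (hw' : ∀ l y, |w l y| ≤ wmax) {a : Fin (k + 1) → ℝ}
    (ha : ∀ l, 0 ≤ a l) {amin wmin : ℝ} (hamin : 0 < amin) (hwmin : 0 < wmin)
    (hcov : ∀ x, ∃ l : Fin (k + 1), amin ≤ a l ∧ wmin ≤ |w l (towerBlk (torusTower hM hdiv) (l : ℕ) x)|)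
    {M₀ : ℕ} (hM₀ : 1 ≤ M₀) (hdiv₀ : ∀ i, M₀ ∣ N i) (h2N : ∀ i, 2 * M₀ ≤ N i)
    {κ : ℝ} (hκ0 : 0 ≤ κ) (hκ : κ < thetaD d M amin wmin cmin cmax wmax k a)
    (hρ : wrsSmallness d M amin wmin cmin cmax wmax k a (Fintype.card Cp) M₀ κ < 1) (p : UT N × Cp) :
    ∑ q, |Ring.inverse (towerOpT hM hdiv c Rm k w a) (Pi.single q 1) p| * Real.exp (κ * dist p.1 q.1) ≤
      wrsConst d M amin wmin cmin cmax wmax k a (Fintype.card Cp) M₀ κ := by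
  have h := (walkInversion_tower_torus hM hdiv c hcmin hc hc' Rm hRm k w hw' ha hamin hwmin hcov hM₀ hdiv₀ h2N
    hκ0 hκ hρ).2.2 p
  rw [← cmat_inverse_towerOp hM hdiv c hcmin hc Rm hRm k w ha hamin hwmin hcov, wrs_cmat_eq] at h
  simpa [dTorus_apply] using h



/-- **AT s ≡ 1 THE SUM OF THE DECORATED FAMILY IS `cmat Δ′⁻¹`** (d4-p3's `termSum_decFamily_one` BY NAME: the resummation
identity + the entrywise Neumann series in the (2.16)-currency + `cmat_inverse_towerOp`); κ₁ > 0 so that σ = 1 lies in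
the disc. [folklore] -/
theorem termSum_tower_torus_one {M : ℕ → ℕ} (hM : ∀ j, 1 ≤ M j) (hdiv : ∀ j i, M j ∣ N i)
    (c : UT N × Fin d → ℝ) {cmin cmax : ℝ} (hcmin : 0 < cmin) (hc : ∀ b, cmin ≤ |c b|) (hc' : ∀ b, |c b| ≤ cmax)
    (Rm : UT N × Fin d → Cp → Cp → ℝ) (hRm : ∀ b i j, ∑ k, Rm b k i * Rm b k j = if i = j then (1 : ℝ) else 0)
    (k : ℕ) (w : Fin (k + 1) → UT N → ℝ) {wmax : ℝ} (hw' : ∀ l y, |w l y| ≤ wmax) {a : Fin (k + 1) → ℝ}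
    (ha : ∀ l, 0 ≤ a l) {amin wmin : ℝ} (hamin : 0 < amin) (hwmin : 0 < wmin)
    (hcov : ∀ x, ∃ l : Fin (k + 1), amin ≤ a l ∧ wmin ≤ |w l (towerBlk (torusTower hM hdiv) (l : ℕ) x)|)
    {M₀ : ℕ} (hM₀ : 1 ≤ M₀) (hdiv₀ : ∀ i, M₀ ∣ N i) (h2N : ∀ i, 2 * M₀ ≤ N i)
    {κ κ₁ : ℝ} (hκ0 : 0 ≤ κ) (hκ₁ : 0 < κ₁)
    (hκ : κ + rateShift d M k M₀ κ₁ < thetaD d M amin wmin cmin cmax wmax k a)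
    (hρ : wrsSmallness d M amin wmin cmin cmax wmax k a (Fintype.card Cp) M₀ (κ + rateShift d M k M₀ κ₁) < 1)
    (Δ₀ : Ctr N M₀) :
    termSum (decFamily (hTorus N Cp M₀) (cmat (towerOpT hM hdiv c Rm k w a) - 1) (LTorus hM hdiv c Rm k w a M₀)
        (tubeDec (cellTorus hM₀ hdiv₀ h2N Cp) (ETorus hM hdiv k M₀ Cp)) (fun _ => (1 : ℂ)) Δ₀) 1 =
      cmat (Ring.inverse (towerOpT hM hdiv c Rm k w a)) := by
  have hd0 : (0 : ℝ) < d := by exact_mod_cast Nat.pos_of_ne_zero (NeZero.ne d)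
  have hM0 : (0 : ℝ) < M₀ := by exact_mod_cast hM₀
  have hcmax : 0 ≤ cmax := le_trans (le_trans hcmin.le (hc (ctrU N M₀ (fun _ => ⟨0, B5TorusCover.one_le_nC _ _⟩),
    ⟨0, Nat.pos_of_ne_zero (NeZero.ne d)⟩))) (hc' _)
  have hwmax : 0 ≤ wmax := (abs_nonneg _).trans (hw' 0 (ctrU N M₀ fun _ => ⟨0, B5TorusCover.one_le_nC _ _⟩))
  have hW : ∀ (l : Fin (k + 1)) (x : UT N), |w l (towerBlk (torusTower hM hdiv) (l : ℕ) x)| ≤ wmax :=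
    fun l x => hw' l _
  set κ' := κ + rateShift d M k M₀ κ₁ with hκ'def
  have hκκ' : κ ≤ κ' := le_add_of_nonneg_right (by unfold rateShift; positivity)
  have hκ'0 : 0 ≤ κ' := hκ0.trans hκκ'
  have hwt := weightHyp_dTorus (N := N) (Cp := Cp) hκ0
  have hwt' := weightHyp_dTorus (N := N) (Cp := Cp) hκ'0
  -- the row data at τ ≡ 1
  have hRD := rowData_tower_torus hM hdiv c hcmin hc hc' Rm hRm k w hw' ha hamin hwmin hcov hM₀ hdiv₀ h2N hκ0 hκ₁.le
    hκ hρ (fun _ => (1 : ℂ)) (fun _ => by rw [norm_one]; exact Real.one_le_exp hκ₁.le) Δ₀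
  -- the resummation identity and the remainder bound (at the shifted rate, lowered to κ)
  have hid := resummation_identity (cmat (towerOpT hM hdiv c Rm k w a) - 1) (hTorus N Cp M₀) (ETorus hM hdiv k M₀ Cp)
    (LTorus hM hdiv c Rm k w a M₀) (sum_hTorus_sq hM₀ hdiv₀ h2N) (fun z p hp => hTorus_supp hM hdiv k hM₀ z p hp)
    (fun z => Pj_mul_LTorus hM hdiv c Rm k w a M₀ z)
    (fun z => local_inverse_LTorus hM hdiv c hcmin hc Rm hRm k w ha hamin hwmin hcov M₀ z)
  have hRem' := wrs_Rem hwt' (cmat (towerOpT hM hdiv c Rm k w a) - 1) (hTorus N Cp M₀) (ETorus hM hdiv k M₀ Cp)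
    (LTorus hM hdiv c Rm k w a M₀) (fun z p hp => hTorus_supp hM hdiv k hM₀ z p hp) (hTorus_abs M₀)
    (M := (M₀ : ℝ) / (4 * d)) (N := coverNumber d M k M₀)
    (C_L := localConst d M amin wmin cmin cmax wmax k a (Fintype.card Cp) κ')
    (K₁ := momentConst d M cmax wmax k a (Fintype.card Cp) κ')
    (by positivity) (fun z p q => hTorus_lip hM₀ z p q) (fun p => card_ETorus_le hM hdiv k hM₀ p)
    (localConst_nonneg d M cmin cmax wmax k a _ hκ.le hamin hwmin)
    (fun z => wrs_LTorus hM hdiv c hcmin hc hc' Rm hRm k w hw' ha hamin hwmin hcov hκ M₀ z)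
    (fun p => by
      simpa [dTorus_apply, towerOpT] using
        firstMoment_towerOp_le hM hdiv c hcmax hc' Rm hRm k
          (W := fun l x => w l (towerBlk (torusTower hM hdiv) (l : ℕ) x)) hwmax hW ha hκ'0 p)
  have hRem := WRS.of_rate_le hRem' hκκ' (fun p q => by rw [dTorus_apply]; exact dist_nonneg)
  have hρ' : 2 * coverNumber d M k M₀ / ((M₀ : ℝ) / (4 * d)) *
      localConst d M amin wmin cmin cmax wmax k a (Fintype.card Cp) κ' *
      momentConst d M cmax wmax k a (Fintype.card Cp) κ' < 1 := by simpa [wrsSmallness, hκ'def] using hρ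
  have h1 : (1 : ℂ) ∈ ball (0 : ℂ) (Real.exp κ₁) := by
    rw [mem_ball_zero_iff, norm_one]
    exact Real.one_lt_exp_iff.mpr hκ₁ |> fun h => by simpa using h
  have h := termSum_decFamily_one hwt hid hRem hρ' _ Δ₀ hRD h1
  rw [h, add_sub_cancel, cmat_inverse_towerOp hM hdiv c hcmin hc Rm hRm k w ha hamin hwmin hcov]

end Row

end

end Summit.QuantumFields.BalabanUV.Beta.CovariantTowerRowData
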